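import Mathlib.LinearAlgebra.Matrix.Charpoly.Coeff
import Mathlib.LinearAlgebra.Matrix.NonsingularInverse
import Mathlib.LinearAlgebra.Matrix.Trace
import Mathlib.LinearAlgebra.Matrix.Notation
import Mathlib.Tactic.Module
import HarnessLib

/-!
# F0 · P3c · ROAD «ELL-INNER» (E2b) «SLOT-AUT», FILE A — the `2 × 2` SPECTRAL-IDEMPOTENT CALCULUS behind the slot permutations of an elliptic torus of
# `U(Φ₂) × U(Φ₁)` [Rogawski1990 §3.6–§3.7; folklore linear algebra]

Cell `pub/hodgecm-mathlib`, crux H413 = `stmt-HodgeConjecture-24833` (lane `--supports … --as helper`), route HCCMUnconditional; ROAD «ELL-INNER» (map owner LH6-p03 (g7),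
desk F0P3-plan (g18) GO 2026-09-02T20:08:17Z, LEAD T14-44), brick (E2b) «SLOT-AUT» (CENSUS `F0/P3a/F0P3a-p03/g27/e2b/CENSUS-E2b-SlotAut.v1.F0P3ap03g27.md`); seat F0P3a-p03 (g27).
THEOREMS ONLY (no definition ∕ instance ∕ notation ∕ named fact ∕ `sorry`); Mathlib-only imports.  GENERIC over a commutative ring `R` (with a ring endomorphism `σ` and a form
`J` where the unitary structure enters) — the CM carriers appear only in FILE B.

WHAT.  For a `2 × 2` matrix `P` with `P² = P` and `tr P = 1` (a «rank-one idempotent», e.g. a spectral idempotent of a regular semisimple `g`):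
* §1 `idem_entries` (the entry relations `qr = ps`, …), **`idem_mul_mul_idem_eq_trace_smul`** `P m P = tr(P m) • P` (ALL commutative rings — four `linear_combination`s),
  `det_idem_eq_zero`, `trace_one_sub_idem`, `one_sub_idem_mul_self`, the orthogonality `P (1 − P) = 0 = (1 − P) P`;
* §2 the TWO-IDEMPOTENT CALCULUS with `P₂ := 1 − P₁`: **`eq_trace_smul_add_trace_smul_of_commute`** — a matrix commuting with `P₁` IS `tr(P₁ m) • P₁ + tr(P₂ m) • P₂`;
  `smul_add_smul_mul_smul_add_smul` — `(x P₁ + y P₂)(x′ P₁ + y′ P₂) = xx′ P₁ + yy′ P₂`; `trace ∕ det ∕ charpoly` of `x P₁ + y P₂` (`x + y`, `x y`, `(X − x)(X − y)`);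
  `trace_idem_mul_smul_add_smul` (`tr(P₁ (x P₁ + y P₂)) = x`);
* §3 the SPECTRAL IDEMPOTENT of a split separable quadratic: for `g` with `tr g = a₁ + a₂`, `det g = a₁ a₂` and `a₁ − a₂` a unit, `P₁ := (a₁ − a₂)⁻¹ • (g − a₂ • 1)` satisfies
  `P₁² = P₁`, `tr P₁ = 1`, `g = a₁ • P₁ + a₂ • (1 − P₁)`, and commutes with everything commuting with `g`;
* §4 the ADJOINT CALCULUS for a `σ`-sesquilinear form `J`: if `(σ g)ᵀ J g = J` (`g` unitary) and `a_i σ(a_i) = 1` then **`(σ P₁)ᵀ J = J P₁`** (the spectral idempotents are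
  self-adjoint), hence `(σ M)ᵀ J M = J · ((σx x) P₁ + (σy y) P₂)` for `M = x P₁ + y P₂` (**`adjoint_form_smul_add_smul`**): `M` is unitary for norm-one coordinates
  (**`unitary_smul_add_smul`**) and conversely a unitary `M` has norm-one coordinates when `J` is invertible (**`mul_map_eq_one_of_unitary_smul_add_smul`**).
These are the algebraic facts that make the eigen-coordinate map `t ↦ (tr(P₁ t), tr(P₂ t))` of a compact type-(1) Cartan subgroup of `U(Φ₂)(L⁺_v)` a continuous
isomorphism onto `E¹ × E¹` and the slot permutations (FILE B) continuous group automorphisms.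
HONEST LABEL: count-neutral; `𝔇.Prop1252` stays a PRINTED consequent of `hBlock′` until a ★ rider; HC_CM is proved only modulo the printed citations until rung 0 closes.

## References
* [Rogawski1990] J. D. Rogawski, *Automorphic Representations of Unitary Groups in Three Variables*, Ann. of Math. Stud. 123 (1990): §3.6 pp. 28–31 (Cartan subgroups of
  `U(2)`: the torus `T` is the unit group of the étale algebra `F[γ]`, types by the splitting of `χ_γ`), §3.7 Prop. 3.7.1 p. 31 (`Ω_F(T, G)` versus `Ω(T, H)`).
-/

set_option autoImplicit false
-- the mandated namespace has the single-problem summit's repeated segment (`HodgeConjecture.HodgeConjecture`)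
set_option linter.dupNamespace false

open Matrix Polynomial

namespace Summit.HodgeConjecture.HodgeConjecture.Cruxes.H413.F0P3cStCharTSEllInnerSlotAlgebra

variable {R : Type*} [CommRing R]

/-! ## §1 One rank-one idempotent -/

/-- The entry relations of a `2 × 2` idempotent of trace one: with `P = (p q; r s)`, `p² + qr = p`, `rq + s² = s`, `p + s = 1`, hence `qr = ps`. [folklore] -/
theorem idem_entries {P : Matrix (Fin 2) (Fin 2) R} (hP : P * P = P) (htr : P.trace = 1) :
    P 0 0 * P 0 0 + P 0 1 * P 1 0 = P 0 0 ∧ P 1 0 * P 0 1 + P 1 1 * P 1 1 = P 1 1 ∧ P 0 0 + P 1 1 = 1 ∧ P 0 1 * P 1 0 = P 0 0 * P 1 1 := by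
  have h00 := congrFun (congrFun hP 0) 0
  have h11 := congrFun (congrFun hP 1) 1
  rw [Matrix.mul_apply, Fin.sum_univ_two] at h00 h11
  rw [Matrix.trace_fin_two] at htr
  refine ⟨h00, h11, htr, ?_⟩
  linear_combination h00 - P 0 0 * htr

/-- **`P m P = tr(P m) • P`** for a `2 × 2` idempotent `P` of trace one and ANY `m`, over any commutative ring. [folklore] -/
theorem idem_mul_mul_idem_eq_trace_smul {P : Matrix (Fin 2) (Fin 2) R} (hP : P * P = P) (htr : P.trace = 1) (m : Matrix (Fin 2) (Fin 2) R) :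
    P * m * P = (P * m).trace • P := by
  obtain ⟨-, -, -, hqr⟩ := idem_entries hP htr
  ext i j
  fin_cases i <;> fin_cases j <;>
    simp only [Fin.zero_eta, Fin.mk_one, Fin.isValue, Matrix.smul_apply, Matrix.trace_fin_two, Matrix.mul_apply, Fin.sum_univ_two, smul_eq_mul]
  · linear_combination (m 1 1) * hqr
  · linear_combination (-(m 0 1)) * hqr
  · linear_combination (-(m 1 0)) * hqr
  · linear_combination (m 0 0) * hqr

/-- `det P = 0` for a `2 × 2` idempotent of trace one. [folklore] -/
theorem det_idem_eq_zero {P : Matrix (Fin 2) (Fin 2) R} (hP : P * P = P) (htr : P.trace = 1) : P.det = 0 := by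
  obtain ⟨-, -, -, hqr⟩ := idem_entries hP htr
  rw [Matrix.det_fin_two]
  linear_combination (-1 : R) * hqr

/-- `tr (1 − P) = 1`. [folklore] -/
theorem trace_one_sub_idem {P : Matrix (Fin 2) (Fin 2) R} (htr : P.trace = 1) : (1 - P).trace = 1 := by
  rw [Matrix.trace_sub, Matrix.trace_one, htr, Fintype.card_fin]; norm_num

/-- `(1 − P)² = 1 − P`. [folklore] -/
theorem one_sub_idem_mul_self {P : Matrix (Fin 2) (Fin 2) R} (hP : P * P = P) : (1 - P) * (1 - P) = 1 - P := by
  rw [sub_mul, mul_sub, mul_sub, one_mul, one_mul, mul_one, hP, sub_self, sub_zero]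

/-- `P (1 − P) = 0`. [folklore] -/
theorem idem_mul_one_sub {P : Matrix (Fin 2) (Fin 2) R} (hP : P * P = P) : P * (1 - P) = 0 := by
  rw [mul_sub, mul_one, hP, sub_self]

/-- `(1 − P) P = 0`. [folklore] -/
theorem one_sub_mul_idem {P : Matrix (Fin 2) (Fin 2) R} (hP : P * P = P) : (1 - P) * P = 0 := by
  rw [sub_mul, one_mul, hP, sub_self]

/-! ## §2 The pair `P₁`, `P₂ = 1 − P₁` -/

/-- **STRUCTURE: a matrix commuting with `P₁` is `tr(P₁ m) • P₁ + tr((1 − P₁) m) • (1 − P₁)`** (`m P_i = m P_i P_i = P_i m P_i = tr(P_i m) P_i`, `m = m P₁ + m P₂`). [folklore] -/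
theorem eq_trace_smul_add_trace_smul_of_commute {P m : Matrix (Fin 2) (Fin 2) R} (hP : P * P = P) (htr : P.trace = 1) (hc : m * P = P * m) :
    m = (P * m).trace • P + ((1 - P) * m).trace • (1 - P) := by
  have hP' := one_sub_idem_mul_self hP
  have htr' := trace_one_sub_idem htr
  have hc' : m * (1 - P) = (1 - P) * m := by rw [mul_sub, sub_mul, mul_one, one_mul, hc]
  have h1 : m * P = (P * m).trace • P := by
    calc m * P = m * P * P := by rw [mul_assoc, hP]
      _ = P * m * P := by rw [hc]
      _ = (P * m).trace • P := idem_mul_mul_idem_eq_trace_smul hP htr m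
  have h2 : m * (1 - P) = ((1 - P) * m).trace • (1 - P) := by
    calc m * (1 - P) = m * (1 - P) * (1 - P) := by rw [mul_assoc, hP']
      _ = (1 - P) * m * (1 - P) := by rw [hc']
      _ = ((1 - P) * m).trace • (1 - P) := idem_mul_mul_idem_eq_trace_smul hP' htr' m
  calc m = m * P + m * (1 - P) := by rw [mul_sub, mul_one, add_sub_cancel]
    _ = _ := by rw [h1, h2]

/-- `(x P₁ + y P₂)(x′ P₁ + y′ P₂) = xx′ P₁ + yy′ P₂`. [folklore] -/
theorem smul_add_smul_mul_smul_add_smul {P : Matrix (Fin 2) (Fin 2) R} (hP : P * P = P) (x y x' y' : R) :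
    (x • P + y • (1 - P)) * (x' • P + y' • (1 - P)) = (x * x') • P + (y * y') • (1 - P) := by
  rw [add_mul, mul_add, mul_add, smul_mul_smul_comm, smul_mul_smul_comm, smul_mul_smul_comm, smul_mul_smul_comm, hP, idem_mul_one_sub hP, one_sub_mul_idem hP,
    one_sub_idem_mul_self hP, smul_zero, smul_zero, add_zero, zero_add]

/-- `tr (x P₁ + y P₂) = x + y`. [folklore] -/
theorem trace_smul_add_smul {P : Matrix (Fin 2) (Fin 2) R} (htr : P.trace = 1) (x y : R) : (x • P + y • (1 - P)).trace = x + y := by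
  rw [Matrix.trace_add, Matrix.trace_smul, Matrix.trace_smul, htr, trace_one_sub_idem htr, smul_eq_mul, smul_eq_mul, mul_one, mul_one]

/-- `tr (P₁ (x P₁ + y P₂)) = x`, `tr (P₂ (x P₁ + y P₂)) = y` — the eigen-coordinates are read by traces. [folklore] -/
theorem trace_idem_mul_smul_add_smul {P : Matrix (Fin 2) (Fin 2) R} (hP : P * P = P) (htr : P.trace = 1) (x y : R) :
    (P * (x • P + y • (1 - P))).trace = x ∧ ((1 - P) * (x • P + y • (1 - P))).trace = y := by
  rw [mul_add, mul_add, Matrix.mul_smul, Matrix.mul_smul, Matrix.mul_smul, Matrix.mul_smul, hP, idem_mul_one_sub hP, one_sub_mul_idem hP, one_sub_idem_mul_self hP,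
    smul_zero, smul_zero, add_zero, zero_add, Matrix.trace_smul, Matrix.trace_smul, htr, trace_one_sub_idem htr, smul_eq_mul, smul_eq_mul, mul_one, mul_one]
  exact ⟨rfl, rfl⟩

/-- `det (x P₁ + y P₂) = x y` (`= det (y + (x − y) P₁) = y² + y (x − y) tr P₁ + (x − y)² det P₁`). [folklore] -/
theorem det_smul_add_smul {P : Matrix (Fin 2) (Fin 2) R} (hP : P * P = P) (htr : P.trace = 1) (x y : R) : (x • P + y • (1 - P)).det = x * y := by
  obtain ⟨-, -, hps, hqr⟩ := idem_entries hP htr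
  rw [Matrix.det_fin_two]
  simp only [Matrix.add_apply, Matrix.smul_apply, Matrix.sub_apply, Matrix.one_apply_eq, Matrix.one_apply_ne (show (0 : Fin 2) ≠ 1 by decide),
    Matrix.one_apply_ne (show (1 : Fin 2) ≠ 0 by decide), smul_eq_mul]
  linear_combination (y * (x - y)) * hps - (x - y) ^ 2 * hqr

/-- `charpoly (x P₁ + y P₂) = (X − x)(X − y)`. [folklore] -/
theorem charpoly_smul_add_smul [Nontrivial R] {P : Matrix (Fin 2) (Fin 2) R} (hP : P * P = P) (htr : P.trace = 1) (x y : R) :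
    (x • P + y • (1 - P)).charpoly = (X - C x) * (X - C y) := by
  rw [Matrix.charpoly_fin_two, trace_smul_add_smul htr, det_smul_add_smul hP htr, map_add, map_mul]
  ring

/-- `x P₁ + y P₂` times `x̄ P₁ + ȳ P₂` is `1` when `x x̄ = 1 = y ȳ`. [folklore] -/
theorem smul_add_smul_mul_eq_one {P : Matrix (Fin 2) (Fin 2) R} (hP : P * P = P) {x y xb yb : R} (hx : x * xb = 1) (hy : y * yb = 1) :
    (x • P + y • (1 - P)) * (xb • P + yb • (1 - P)) = 1 := by
  rw [smul_add_smul_mul_smul_add_smul hP, hx, hy, one_smul, one_smul, add_sub_cancel]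

/-! ## §3 The spectral idempotent of a split separable quadratic -/

section Spectral

variable {g : Matrix (Fin 2) (Fin 2) R} {a₁ a₂ : R} (δ : Rˣ)

/-- **Cayley–Hamilton, split form**: `tr g = a₁ + a₂`, `det g = a₁ a₂` ⇒ `(g − a₁)(g − a₂) = 0` (direct `2 × 2` computation). [folklore] -/
theorem sub_mul_sub_eq_zero (htr : g.trace = a₁ + a₂) (hdet : g.det = a₁ * a₂) :
    (g - a₁ • (1 : Matrix (Fin 2) (Fin 2) R)) * (g - a₂ • (1 : Matrix (Fin 2) (Fin 2) R)) = 0 := by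
  rw [Matrix.trace_fin_two] at htr
  rw [Matrix.det_fin_two] at hdet
  ext i j
  fin_cases i <;> fin_cases j <;>
    simp only [Fin.zero_eta, Fin.mk_one, Fin.isValue, Matrix.mul_apply, Fin.sum_univ_two, Matrix.sub_apply, Matrix.smul_apply, Matrix.one_apply_eq,
      Matrix.one_apply_ne (show (0 : Fin 2) ≠ 1 by decide), Matrix.one_apply_ne (show (1 : Fin 2) ≠ 0 by decide), smul_eq_mul, mul_one, mul_zero, sub_zero,
      Matrix.zero_apply]
  · linear_combination (g 0 0) * htr - hdet
  · linear_combination (g 0 1) * htr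
  · linear_combination (g 1 0) * htr
  · linear_combination (g 1 1) * htr - hdet

/-- **The spectral idempotent** `P₁ := δ⁻¹ • (g − a₂ • 1)`, `δ = a₁ − a₂` a unit: `P₁² = P₁`. [cite: Rogawski1990, §3.6 p. 28] -/
theorem spectralIdem_mul_self (htr : g.trace = a₁ + a₂) (hdet : g.det = a₁ * a₂) (hδ : (δ : R) = a₁ - a₂) :
    ((↑δ⁻¹ : R) • (g - a₂ • (1 : Matrix (Fin 2) (Fin 2) R))) * ((↑δ⁻¹ : R) • (g - a₂ • (1 : Matrix (Fin 2) (Fin 2) R))) =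
      (↑δ⁻¹ : R) • (g - a₂ • (1 : Matrix (Fin 2) (Fin 2) R)) := by
  -- `(g − a₂)² = (g − a₁)(g − a₂) + δ (g − a₂) = δ (g − a₂)`
  have hsq : (g - a₂ • (1 : Matrix (Fin 2) (Fin 2) R)) * (g - a₂ • (1 : Matrix (Fin 2) (Fin 2) R)) = (δ : R) • (g - a₂ • (1 : Matrix (Fin 2) (Fin 2) R)) := by
    have h0 := sub_mul_sub_eq_zero htr hdet
    have hrew : g - a₂ • (1 : Matrix (Fin 2) (Fin 2) R) = (g - a₁ • (1 : Matrix (Fin 2) (Fin 2) R)) + (δ : R) • (1 : Matrix (Fin 2) (Fin 2) R) := by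
      rw [hδ]; module
    nth_rw 1 [hrew]
    rw [add_mul, h0, zero_add, smul_mul_assoc, one_mul]
  rw [smul_mul_smul_comm, hsq, smul_smul, mul_assoc, Units.inv_mul, mul_one]

/-- `tr P₁ = 1`. [cite: Rogawski1990, §3.6 p. 28] -/
theorem trace_spectralIdem (htr : g.trace = a₁ + a₂) (hδ : (δ : R) = a₁ - a₂) :
    ((↑δ⁻¹ : R) • (g - a₂ • (1 : Matrix (Fin 2) (Fin 2) R))).trace = 1 := by
  rw [Matrix.trace_smul, Matrix.trace_sub, Matrix.trace_smul, Matrix.trace_one, htr, Fintype.card_fin, smul_eq_mul, smul_eq_mul]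
  have h2 : a₁ + a₂ - a₂ * ((2 : ℕ) : R) = (δ : R) := by rw [hδ]; push_cast; ring
  rw [h2, Units.inv_mul]

/-- `g = a₁ • P₁ + a₂ • (1 − P₁)` — the spectral decomposition. [cite: Rogawski1990, §3.6 p. 28] -/
theorem eq_smul_spectralIdem_add (hδ : (δ : R) = a₁ - a₂) :
    g = a₁ • ((↑δ⁻¹ : R) • (g - a₂ • (1 : Matrix (Fin 2) (Fin 2) R))) + a₂ • (1 - (↑δ⁻¹ : R) • (g - a₂ • (1 : Matrix (Fin 2) (Fin 2) R))) := by
  have hu : (a₁ - a₂) * (↑δ⁻¹ : R) = 1 := by rw [← hδ, Units.mul_inv]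
  match_scalars <;> first | linear_combination (-1 : R) * hu | linear_combination a₂ * hu

/-- Anything commuting with `g` commutes with `P₁`. [folklore] -/
theorem commute_spectralIdem_of_commute {m : Matrix (Fin 2) (Fin 2) R} (hm : m * g = g * m) :
    m * ((↑δ⁻¹ : R) • (g - a₂ • (1 : Matrix (Fin 2) (Fin 2) R))) = ((↑δ⁻¹ : R) • (g - a₂ • (1 : Matrix (Fin 2) (Fin 2) R))) * m := by
  rw [mul_smul_comm, smul_mul_assoc]
  congr 1
  rw [mul_sub, sub_mul, hm, mul_smul_comm, smul_mul_assoc, mul_one, one_mul]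

end Spectral

/-! ## §4 The adjoint calculus for a `σ`-sesquilinear form `J` -/

section Adjoint

variable (σ : R →+* R) (J : Matrix (Fin 2) (Fin 2) R)

/-- `(σ (x • M))ᵀ = σ x • (σ M)ᵀ`. [folklore] -/
theorem transpose_map_smul (x : R) (M : Matrix (Fin 2) (Fin 2) R) : ((x • M).map σ)ᵀ = σ x • (M.map σ)ᵀ := by
  ext i j; simp [Matrix.transpose_apply, Matrix.map_apply, smul_eq_mul]

/-- `(σ (M + N))ᵀ = (σ M)ᵀ + (σ N)ᵀ`. [folklore] -/
theorem transpose_map_add (M N : Matrix (Fin 2) (Fin 2) R) : ((M + N).map σ)ᵀ = (M.map σ)ᵀ + (N.map σ)ᵀ := by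
  ext i j; simp [Matrix.transpose_apply, Matrix.map_apply]

/-- `(σ (M − N))ᵀ = (σ M)ᵀ − (σ N)ᵀ`. [folklore] -/
theorem transpose_map_sub (M N : Matrix (Fin 2) (Fin 2) R) : ((M - N).map σ)ᵀ = (M.map σ)ᵀ - (N.map σ)ᵀ := by
  ext i j; simp [Matrix.transpose_apply, Matrix.map_apply]

/-- `(σ 1)ᵀ = 1`. [folklore] -/
theorem transpose_map_one : ((1 : Matrix (Fin 2) (Fin 2) R).map σ)ᵀ = 1 := by
  rw [Matrix.map_one σ (map_zero σ) (map_one σ), Matrix.transpose_one]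

/-- **THE SPECTRAL IDEMPOTENTS OF A UNITARY ELEMENT WITH NORM-ONE EIGENVALUES ARE SELF-ADJOINT**: if `(σ g)ᵀ J g = J`, `P₁ = δ⁻¹ • (g − a₂ • 1)` is idempotent (`δ = a₁ − a₂` a unit)
and `a₁ σ(a₁) = a₂ σ(a₂) = 1`, then **`(σ P₁)ᵀ J = J P₁`**.  (`(σ g)ᵀ J = J g⁻¹`, `g⁻¹ = σ(a₁) P₁ + σ(a₂) P₂`, so `(σ g)ᵀ J − σ(a₂) J = σ(δ) J P₁`.)
[cite: Rogawski1990, §3.6 p. 28; §3.7 Prop. 3.7.1 p. 31] -/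
theorem transpose_map_spectralIdem_mul_eq {g : Matrix (Fin 2) (Fin 2) R} {a₁ a₂ : R} (δ : Rˣ) (hδ : (δ : R) = a₁ - a₂)
    (hP : ((↑δ⁻¹ : R) • (g - a₂ • (1 : Matrix (Fin 2) (Fin 2) R))) * ((↑δ⁻¹ : R) • (g - a₂ • (1 : Matrix (Fin 2) (Fin 2) R))) = (↑δ⁻¹ : R) • (g - a₂ • (1 : Matrix (Fin 2) (Fin 2) R)))
    (hg : (g.map σ)ᵀ * J * g = J) (ha₁ : a₁ * σ a₁ = 1) (ha₂ : a₂ * σ a₂ = 1) :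
    (((↑δ⁻¹ : R) • (g - a₂ • (1 : Matrix (Fin 2) (Fin 2) R))).map σ)ᵀ * J = J * ((↑δ⁻¹ : R) • (g - a₂ • (1 : Matrix (Fin 2) (Fin 2) R))) := by
  set P : Matrix (Fin 2) (Fin 2) R := (↑δ⁻¹ : R) • (g - a₂ • (1 : Matrix (Fin 2) (Fin 2) R)) with hPdef
  -- a right inverse of `g`: `h := σ(a₁) P + σ(a₂) (1 − P)`
  have hgdec : g = a₁ • P + a₂ • (1 - P) := eq_smul_spectralIdem_add δ hδ
  have hgh : g * (σ a₁ • P + σ a₂ • (1 - P)) = 1 := by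
    conv_lhs => rw [hgdec]
    exact smul_add_smul_mul_eq_one hP ha₁ ha₂
  -- `(σ g)ᵀ J = J h`
  have hadj : (g.map σ)ᵀ * J = J * (σ a₁ • P + σ a₂ • (1 - P)) := by
    calc (g.map σ)ᵀ * J = (g.map σ)ᵀ * J * (g * (σ a₁ • P + σ a₂ • (1 - P))) := by rw [hgh, mul_one]
      _ = (g.map σ)ᵀ * J * g * (σ a₁ • P + σ a₂ • (1 - P)) := by rw [← mul_assoc]
      _ = J * (σ a₁ • P + σ a₂ • (1 - P)) := by rw [hg]
  -- `(σ P)ᵀ = σ(δ⁻¹) • ((σ g)ᵀ − σ(a₂) • 1)`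
  have hPt : (P.map σ)ᵀ = σ (↑δ⁻¹ : R) • ((g.map σ)ᵀ - σ a₂ • (1 : Matrix (Fin 2) (Fin 2) R)) := by
    rw [hPdef, transpose_map_smul, transpose_map_sub, transpose_map_smul, transpose_map_one]
  have hσδ : σ (↑δ⁻¹ : R) * σ (a₁ - a₂) = 1 := by rw [← map_mul, ← hδ, Units.inv_mul, map_one]
  -- `(σa₁ P + σa₂ (1 − P)) − σa₂ • 1 = σ(a₁ − a₂) • P`
  have hin : J * (σ a₁ • P + σ a₂ • (1 - P)) - σ a₂ • J = J * (σ (a₁ - a₂) • P) := by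
    simp only [map_sub, sub_smul, smul_sub, mul_sub, mul_add, Matrix.mul_smul, Matrix.mul_one]
    abel
  calc (P.map σ)ᵀ * J = σ (↑δ⁻¹ : R) • (((g.map σ)ᵀ - σ a₂ • (1 : Matrix (Fin 2) (Fin 2) R)) * J) := by rw [hPt, smul_mul_assoc]
    _ = σ (↑δ⁻¹ : R) • ((g.map σ)ᵀ * J - σ a₂ • J) := by rw [sub_mul, smul_mul_assoc, one_mul]
    _ = σ (↑δ⁻¹ : R) • (J * (σ (a₁ - a₂) • P)) := by rw [hadj, hin]
    _ = J * P := by rw [mul_smul_comm, smul_smul, hσδ, one_smul]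

/-- `(σ (1 − P))ᵀ J = J (1 − P)` from `(σ P)ᵀ J = J P`. [folklore] -/
theorem transpose_map_one_sub_mul_eq {P : Matrix (Fin 2) (Fin 2) R} (h : (P.map σ)ᵀ * J = J * P) :
    ((1 - P).map σ)ᵀ * J = J * (1 - P) := by
  rw [transpose_map_sub, transpose_map_one, sub_mul, one_mul, h, mul_sub, mul_one]

/-- **The adjoint of `x P₁ + y P₂` against `J`**: `(σ M)ᵀ J M = J · ((σ x · x) P₁ + (σ y · y) P₂)` for self-adjoint idempotents `P₁`, `P₂ = 1 − P₁`. [cite: Rogawski1990, §3.6 p. 28] -/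
theorem adjoint_form_smul_add_smul {P : Matrix (Fin 2) (Fin 2) R} (hP : P * P = P) (h : (P.map σ)ᵀ * J = J * P) (x y : R) :
    ((x • P + y • (1 - P)).map σ)ᵀ * J * (x • P + y • (1 - P)) = J * ((σ x * x) • P + (σ y * y) • (1 - P)) := by
  have h' := transpose_map_one_sub_mul_eq σ J h
  rw [transpose_map_add, transpose_map_smul, transpose_map_smul, add_mul, smul_mul_assoc, smul_mul_assoc, h, h', ← mul_smul_comm, ← mul_smul_comm, ← mul_add,
    mul_assoc, smul_add_smul_mul_smul_add_smul hP]

/-- **`x P₁ + y P₂` is UNITARY for norm-one `x, y`**: `(σ M)ᵀ J M = J`. [cite: Rogawski1990, §3.6 p. 28] -/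
theorem unitary_smul_add_smul {P : Matrix (Fin 2) (Fin 2) R} (hP : P * P = P) (h : (P.map σ)ᵀ * J = J * P) {x y : R} (hx : σ x * x = 1) (hy : σ y * y = 1) :
    ((x • P + y • (1 - P)).map σ)ᵀ * J * (x • P + y • (1 - P)) = J := by
  rw [adjoint_form_smul_add_smul σ J hP h, hx, hy, one_smul, one_smul, add_sub_cancel, mul_one]

/-- **Conversely: a UNITARY `x P₁ + y P₂` has norm-one coordinates** (`J` with unit determinant): `σ x · x = 1` and `σ y · y = 1`. [cite: Rogawski1990, §3.6 p. 28] -/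
theorem mul_map_eq_one_of_unitary_smul_add_smul {P : Matrix (Fin 2) (Fin 2) R} (hP : P * P = P) (htr : P.trace = 1)
    (h : (P.map σ)ᵀ * J = J * P) (hJ : IsUnit J.det) {x y : R} (hu : ((x • P + y • (1 - P)).map σ)ᵀ * J * (x • P + y • (1 - P)) = J) :
    σ x * x = 1 ∧ σ y * y = 1 := by
  have hkey : J * ((σ x * x) • P + (σ y * y) • (1 - P)) = J * 1 := by
    rw [mul_one, ← adjoint_form_smul_add_smul σ J hP h]; exact hu
  have hcancel : (σ x * x) • P + (σ y * y) • (1 - P) = 1 := by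
    have h2 := congrArg (fun M => J⁻¹ * M) hkey
    simpa only [Matrix.nonsing_inv_mul_cancel_left _ _ hJ] using h2
  have hc := trace_idem_mul_smul_add_smul hP htr (σ x * x) (σ y * y)
  rw [hcancel, mul_one, htr, mul_one, trace_one_sub_idem htr] at hc
  exact ⟨hc.1.symm, hc.2.symm⟩

end Adjoint

end Summit.HodgeConjecture.HodgeConjecture.Cruxes.H413.F0P3cStCharTSEllInnerSlotAlgebra
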